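import Summits.QuantumFields.YangMills.Theorems.IR.TypFormatCoarsenCells
import HarnessLib

/-!
# Crux `IR` (stmt-QuantumFields-19354), lane B: MESH COARSENING of the typical-class format Uc — clause (i) and the assembled theorem
# `TypShellCondUKPc ρ β b n ε δ ⇒ TypShellCondUKPc ρ β B 1 (P⁴((εM)^j + j(2+3ε)Mδ + δ)) (P⁴ δ)`, `P = 2(B∕b)+1`, `j(2n+1) ≤ 2(B∕b)`

Helper module for item `stmt-QuantumFields-19354` (`--supports`; it closes nothing).  Part 2 of the mesh coarsening (part 1:
`Theorems/IR/TypFormatCoarsenCells.lean` — fine cells, the coarse class `coarseTyp` «every fine sub-cell typical», clauses (ii)∕(iii)).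

* ★ `clauseIAll_coarseTyp` — clause (i) at the COARSE mesh `B`, window `1`, for the coarse class, from the FINE class's clauses (i) (window `n`,
  threshold `ε`) and (ii) (rarity `δ`) whenever `j(2n+1) ≤ 2(B∕b)`: threshold `P⁴·((ε·shellCount n)^j + j(2+3ε)·shellCount n·δ + δ)`.  Proof: the typical
  block recursion `FiniteSizeCriterion.recursion_decay_typical` on the fine frame `refineGen b w` (every cell union, here the fine region of the coarse region)
  gives single-fine-cell influence `(εM)^j + j(2+3ε)Mδ` at agreement radius `j(2n+1)` and goodness radius `j(2n+1)+1`; the typical chain rule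
  `multiCell_influence_typical` peels the `≤ P⁴` fine cells of the coarse centre cell; fine cells within index distance `2(B∕b)` (`3(B∕b)`) of them have coarse
  index within `2` (`3`) (`coarseIdx_near`) — inside the coarse window (window-with-shell), where the coarse exteriors agree (are coarse-typical, hence
  fine-typical).
* ★★ `typShellCondUKPc_coarsen` — the assembled coarsening of the format (continuous `ρ`, Hausdorff second-countable `G`, `1 ≤ b ≤ B`).
  The Typ twin of g6's `univShellCond_coarsen(_any)`; the rarity budget grows by the factor `P⁴` (at most `P⁴` fine sub-cells per coarse cell), so the
  coarsening serves every FIXED ratio `B∕b` under the onset statement's `∀ δ > 0` (not a `B∕b → ∞` tail).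

HONEST FRAMING: bookkeeping inside one FORMAT of one open gap-crux of a CONDITIONAL chain; the format at a β-dependent mesh is assumed, never proved;
not a gap, not Clay.  No `sorry`; axioms ⊆ {propext, Classical.choice, Quot.sound}; no instances, no notation.
-/

set_option autoImplicit false

noncomputable section

open MeasureTheory
open Literature.MathematicalPhysics
open Literature.MathematicalPhysics.QuantumFieldTheory Literature.MathematicalPhysics.QuantumLattice
open Literature.Probability.LatticeModels
open Summit.QuantumFields.YangMills.Cruxes.IR.Tempered (cellEdges windowCells regionEdges)
open Summit.QuantumFields.YangMills.Cruxes.IR.ShellTempered (windowCellsPlus)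
open Summit.QuantumFields.YangMills.Cruxes.IR.CellTempered.Engine (frameCell frameCell_eq_iff mem_cellEdges_frameCell frame_hC1 finite_frameCell
  regionEdges_union shiftFrame cellEdges_shiftFrame)
open Summit.QuantumFields.YangMills.Cruxes.IR.BlockedActivity (Cell coarseIdx refineGen isFrame_refineGen frameCell_eq_coarseIdx_refineGen
  regionEdges_union_refineGen frame_step)
open Summit.QuantumFields.YangMills.Cruxes.IR.OnsetFormats (shellCount)
open Summit.QuantumFields.YangMills.Cruxes.IR.OnsetFormatsUc (IsFrame TypLocal ClauseIAll ClauseIIukp ClauseIII TypShellCondUKPc)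
open Summit.QuantumFields.YangMills.Cruxes.IR.OnsetFormatsUc.TypBootstrap (regionEdges_shiftFrame_eq frameFS_of_clauseIAll frameRare_of_clauseIIukp)
open Summit.QuantumFields.YangMills.Cruxes.IR.OnsetFormatsUc.TypCoarsen (fineCells coarseTyp mem_fineCells_iff card_fineCells_le frameCell_mem_fineCells
  coarseIdx_near typLocal_coarseTyp clauseIIukp_coarseTyp clauseIII_coarseTyp)
open Summit.QuantumFields.YangMills.Theorems.FiniteSizeCriterion (recursion_decay_typical multiCell_influence_typical)
open Summit.QuantumFields.YangMills.Cruxes.IR.AfPincerUc.Bootstrap (recursionCount_eq_shellCount)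

namespace Summit.QuantumFields.YangMills.Cruxes.IR.OnsetFormatsUc.TypCoarsen

variable {G : Type} [Group G] [TopologicalSpace G] [IsTopologicalGroup G] [CompactSpace G]
  [MeasurableSpace G] [BorelSpace G] [SecondCountableTopology G] [T2Space G] {N : ℕ} (ρ : G →* Matrix (Fin N) (Fin N) ℂ)

section Coarse

variable {B b : ℕ} {w : Fin 4 → ℤ → ℤ} (hb : 1 ≤ b) (hbB : b ≤ B) (hw : AfPincerUc.IsFrame B w)
include hb hbB hw

/-- **Fine clauses (i) + (ii) ⇒ coarse clause (i) at window `1`** for the coarse class, threshold `P⁴·((ε·shellCount n)^j + j(2+3ε)·shellCount n·δ + δ)`,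
`P = 2(B∕b)+1`, whenever `j(2n+1) ≤ 2(B∕b)`.  See the module docstring. -/
theorem clauseIAll_coarseTyp (hρ : Continuous ρ) {β : ℝ} {n : ℕ} {ε δ : ℝ} (hε : 0 ≤ ε) (hεM : ε * shellCount n ≤ 1) (hδ : 0 ≤ δ)
    {Typ : Cell → Set (LGConfig 4 G)} (hT : TypLocal (refineGen b w) Typ) (hI : ClauseIAll ρ β (refineGen b w) n ε Typ)
    (hII : ClauseIIukp ρ β (refineGen b w) δ Typ) (j : ℕ) (hj : j * (2 * n + 1) ≤ 2 * (B / b)) :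
    ClauseIAll ρ β w 1 ((((2 * (B / b) + 1) ^ 4 : ℕ) : ℝ) * ((ε * shellCount n) ^ j + j * ((2 + 3 * ε) * shellCount n * δ) + δ))
      (coarseTyp b w Typ) := by
  classical
  intro c₀ Y' hY' h0 σ σ' htyp hagree f hf hfm hf01
  have hw1 := frame_step hw (hb.trans hbB)
  have hf1 := frame_step (isFrame_refineGen hb hbB hw) hb
  have hK1 : 1 ≤ B / b := (Nat.le_div_iff_mul_le hb).2 (by simpa using hbB)
  have hγ := isSpecification_ymSpecification_of_t2Space (d := 4) ρ hρ β
  -- the kernel region of the shifted coarse frame is a coarse region of `w`, a union of fine cells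
  rw [regionEdges_shiftFrame_eq]
  set Λ := regionEdges w (Y'.image fun c => c + c₀) with hΛdef
  have hΛ : ∀ v v', frameCell (refineGen b w) v = frameCell (refineGen b w) v' → v ∈ Λ → v' ∈ Λ :=
    regionEdges_union_refineGen hb hbB hw _
  -- a link off `Λ` has coarse cell off `Y' + c₀`
  have hoff : ∀ v : QuantumLattice.ZdEdge 4, v ∉ Λ → frameCell w v - c₀ ∉ Y' := by
    intro v hv hmem
    refine hv (Finset.mem_biUnion.2 ⟨frameCell w v, Finset.mem_image.2 ⟨_, hmem, sub_add_cancel _ _⟩, mem_cellEdges_frameCell hw1 v⟩)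
  -- the observable reads the fine cells of the coarse cell `c₀`
  set FC : Finset Cell := fineCells b w c₀ with hFC
  have hGooddep : ∀ c, DependsOn (fun σ : LGConfig 4 G => σ ∈ Typ c) {v | frameCell (refineGen b w) v = c} := fun c U V h =>
    hT.2 c fun e he => h e ((frameCell_eq_iff hf1 e c).2 (Finset.mem_coe.1 he))
  have hHdep : DependsOn f {v | frameCell (refineGen b w) v ∈ FC} := by
    intro U V h
    refine hf fun e he => h e ?_
    rw [cellEdges_shiftFrame, zero_add, Finset.mem_coe, ← frameCell_eq_iff hw1] at he
    show frameCell (refineGen b w) e ∈ FC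
    rw [hFC, ← he]
    exact frameCell_mem_fineCells hb hbB hw e
  -- coarse index geometry from a fine cell of `c₀`
  have hgeo : ∀ (y : Cell), y ∈ FC → ∀ (c : Cell) (m : ℕ), (∀ i, |c i - y i| ≤ m * ((B / b : ℕ) : ℤ)) →
      ∀ i, |coarseIdx b w i (c i) - c₀ i| ≤ m := by
    intro y hy c m hc i
    have hyc : coarseIdx b w i (y i) = c₀ i := congr_fun ((mem_fineCells_iff hb hbB hw c₀ y).1 hy) i
    exact coarseIdx_near hb hbB hw i hyc m (hc i)
  -- the chain rule over the fine cells of the coarse centre cell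
  have hchain := multiCell_influence_typical (cell := frameCell (refineGen b w))
    (near := fun y v => ∀ i, |frameCell (refineGen b w) v i - y i| ≤ j * (2 * n + 1))
    (fun v i => by rw [sub_self, abs_zero]; positivity)
    (tnear := fun y c => ∀ i, |c i - y i| ≤ j * (2 * n + 1) + 1)
    (adj := fun y c => ∀ i, |c i - y i| ≤ 1)
    (fun y c h i => (h i).trans (by nlinarith)) hT.1 hGooddep hγ hδ
    (recursion_decay_typical (d := 4) hγ (fun Λ g T hg hT' => dependsOn_integral_ymSpecification ρ hρ β Λ hg hT')
      (cell := frameCell (refineGen b w)) (frame_hC1 hf1) (finite_frameCell hf1) (Good := Typ) hT.1 hGooddep hε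
      (by rwa [recursionCount_eq_shellCount]) (frameFS_of_clauseIAll ρ hf1 hI) hδ (frameRare_of_clauseIIukp ρ hδ hf1 hII) j)
    (frameRare_of_clauseIIukp ρ hδ hf1 hII) FC Λ hΛ f hfm hf01 hHdep σ σ' ?_ ?_
  rotate_left
  · -- agreement: a link off `Λ` within fine distance `j(2n+1) ≤ 2(B∕b)` of a fine cell of `c₀` lies in a coarse window cell off `Y'`
    intro y hy v hv hd
    set d : Cell := frameCell w v with hd'
    have hdc : d = fun i => coarseIdx b w i (frameCell (refineGen b w) v i) := frameCell_eq_coarseIdx_refineGen hb hbB hw v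
    have hnear2 : ∀ i, |d i - c₀ i| ≤ 2 := fun i => by
      have h := hgeo y hy (frameCell (refineGen b w) v) 2 (fun i => (hd i).trans (by push_cast; exact_mod_cast hj)) i
      rw [hdc]; exact_mod_cast h
    have hW : d - c₀ ∈ windowCells 1 := by
      simp only [Summit.QuantumFields.YangMills.Cruxes.IR.Tempered.windowCells, Fintype.mem_piFinset, Finset.mem_Icc, Pi.sub_apply]
      intro i; have h := abs_le.1 (hnear2 i); push_cast; constructor <;> linarith [h.1, h.2]
    have hWP : d - c₀ ∈ windowCellsPlus 1 := by
      simp only [Summit.QuantumFields.YangMills.Cruxes.IR.ShellTempered.windowCellsPlus, Fintype.mem_piFinset, Finset.mem_Icc, Pi.sub_apply]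
      intro i; have h := abs_le.1 (hnear2 i); push_cast; constructor <;> linarith [h.1, h.2]
    refine hagree (d - c₀) hWP (hoff v hv) hW v ?_
    rw [cellEdges_shiftFrame, sub_add_cancel]
    exact mem_cellEdges_frameCell hw1 v
  · -- goodness: a fine cell within fine distance `j(2n+1)+1 ≤ 3(B∕b)` of a fine cell of `c₀`, off `Λ`, lies in a coarse-typical coarse cell
    intro y hy c hc v hvc hv
    set d : Cell := fun i => coarseIdx b w i (c i) with hd'
    have hvd : frameCell w v = d := by rw [frameCell_eq_coarseIdx_refineGen hb hbB hw v, hvc]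
    have hnear3 : ∀ i, |d i - c₀ i| ≤ 3 := fun i => by
      have h := hgeo y hy c 3 (fun i => (hc i).trans (by push_cast; nlinarith [hj, hK1])) i
      exact_mod_cast h
    have hWP : d - c₀ ∈ windowCellsPlus 1 := by
      simp only [Summit.QuantumFields.YangMills.Cruxes.IR.ShellTempered.windowCellsPlus, Fintype.mem_piFinset, Finset.mem_Icc, Pi.sub_apply]
      intro i; have h := abs_le.1 (hnear3 i); push_cast; constructor <;> linarith [h.1, h.2]
    have hdY : d - c₀ ∉ Y' := by rw [← hvd]; exact hoff v hv
    have hcd : c ∈ fineCells b w d := (mem_fineCells_iff hb hbB hw d c).2 rfl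
    obtain ⟨h1, h2⟩ := htyp (d - c₀) hWP hdY
    simp only [sub_add_cancel, coarseTyp, Set.mem_setOf_eq] at h1 h2
    exact ⟨h1 c hcd, h2 c hcd⟩
  -- assemble: `#FC ≤ P⁴`
  refine hchain.trans ?_
  rw [recursionCount_eq_shellCount]
  have hcard : (FC.card : ℝ) ≤ (((2 * (B / b) + 1) ^ 4 : ℕ) : ℝ) := by exact_mod_cast card_fineCells_le hb hw c₀
  have hSn : 0 ≤ shellCount n := by
    unfold Summit.QuantumFields.YangMills.Cruxes.IR.OnsetFormats.shellCount; positivity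
  have hsum : 0 ≤ (ε * shellCount n) ^ j + (j : ℝ) * ((2 + 3 * ε) * shellCount n * δ) + δ := by
    have h1 : 0 ≤ (ε * shellCount n) ^ j := pow_nonneg (mul_nonneg hε hSn) j
    have h2 : 0 ≤ (j : ℝ) * ((2 + 3 * ε) * shellCount n * δ) :=
      mul_nonneg (Nat.cast_nonneg _) (mul_nonneg (mul_nonneg (by linarith) hSn) hδ)
    linarith
  exact mul_le_mul_of_nonneg_right hcard hsum

end Coarse

/-- **THE MESH COARSENING OF FORMAT Uc.**  For continuous `ρ` on a Hausdorff second-countable compact group, `1 ≤ b ≤ B`, `0 ≤ ε`, `ε·shellCount n ≤ 1`,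
`0 ≤ δ` and `j(2n+1) ≤ 2(B∕b)`: `TypShellCondUKPc ρ β b n ε δ ⇒ TypShellCondUKPc ρ β B 1 (P⁴·((ε·shellCount n)^j + j(2+3ε)·shellCount n·δ + δ)) (P⁴·δ)`,
`P = 2(B∕b)+1` — every mesh-`B` frame is refined into a mesh-`b` frame (`refineGen`), whose class induces the coarse class «every fine sub-cell typical». -/
theorem typShellCondUKPc_coarsen (hρ : Continuous ρ) {β : ℝ} {b B n : ℕ} {ε δ : ℝ} (hb : 1 ≤ b) (hbB : b ≤ B) (hε : 0 ≤ ε)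
    (hεM : ε * shellCount n ≤ 1) (hδ : 0 ≤ δ) (j : ℕ) (hj : j * (2 * n + 1) ≤ 2 * (B / b)) (h : TypShellCondUKPc ρ β b n ε δ) :
    TypShellCondUKPc ρ β B 1 ((((2 * (B / b) + 1) ^ 4 : ℕ) : ℝ) * ((ε * shellCount n) ^ j + j * ((2 + 3 * ε) * shellCount n * δ) + δ))
      ((((2 * (B / b) + 1) ^ 4 : ℕ) : ℝ) * δ) := by
  intro w hw
  have hw' : AfPincerUc.IsFrame B w := hw
  obtain ⟨Typ, hT, hI, hII, hIII⟩ := h (refineGen b w) (isFrame_refineGen hb hbB hw')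
  exact ⟨coarseTyp b w Typ, typLocal_coarseTyp hb hbB hw' hT, clauseIAll_coarseTyp ρ hb hbB hw' hρ hε hεM hδ hT hI hII j hj,
    clauseIIukp_coarseTyp ρ hb hbB hw' hδ hII, clauseIII_coarseTyp ρ hb hbB hw' hδ hIII⟩

end Summit.QuantumFields.YangMills.Cruxes.IR.OnsetFormatsUc.TypCoarsen

end
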